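import Literature.Computability.Cryptography.RegevGIVPQuery
import Literature.Computability.Cryptography.RegevDGSReductionWorstCase
import Literature.Computability.Cryptography.RegevDGSSamplesAnalysis
import Literature.Computability.Cryptography.IndepLawBridge
import Literature.Computability.Cryptography.IndependentTrials
import Literature.Probability.Distributions.IndepProductLawDistance
import Literature.Computability.QuantumComplexity.PolyCopiesIdxLaw
import Literature.Computability.QuantumComplexity.PolyCopiesIdxUniform
import Literature.Computability.QuantumComplexity.CWrapAssembly
import Literature.Algebra.EuclideanLattices.RegevRadiusSearch
import HarnessLib

/-!
# Regev 2009, Lemma 3.17 at machine level, III: the `GIVP ≤ DGS` machine and the discharge of `h₃`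

Topic `Computability/Cryptography` (family `pqc`), grouping namespaces `Regev2009.GIVPBlocks` (the
blocks of the machine and their output laws) and `Regev2009.GIVPMachine` (the assembly); sequel of
`RegevGIVPPost.lean` (the post-processor in `FP`) and `RegevGIVPQuery.lean` (the query map in `FP`).
This file assembles Regev's reduction **Lemma 3.17** (`GIVP_{2√n φ} ≤ DGS_φ`, J. ACM 56 (2009),
author's version arXiv:2401.03703, p. 21) as ONE poly-time uniform quantum family and proves its
correctness, i.e. PROVES hypothesis `h₃` of `regev_lwe_to_sivp_quantum_of_worstCase`
(`RegevDGSReductionWorstCase.lean`):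

  `G = CWrap(⟨·, ε⟩, PolyCopiesIdx(block := CWrap(query, D, gcanon), K = (2|x|+2)³ + 1), post)`.

Part A (`Regev2009.GIVPBlocks`) — ONE block and the tuple of blocks. Inside each indexed copy
(`QuantumComplexity/PolyCopiesIdx*.lean`) runs the BLOCK `CWrap.family P` (`QuantumComplexity/CWrap*.lean`)
whose pre-processor is the query map (`GIVPQuery.exists_queryFn`), whose wrapped family is the given
`DGS` sampler `D`, and whose post-processor re-encodes the answer canonically at the front of the
block, `gcanon ⟨x, y⟩ = ⟨fstF y, ε⟩`:

* `gcanon`, `gcanon_mem_FP`, `gcanon_boolPair`; `IsBlockParams P q D` (the data of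
  `CWrap.exists_params`) and `exists_blockParams`;
* `toOuterMeasure_wellFormed_eq_one` (`toOuterMeasure_not_wellFormed_eq_zero`) — the block's output
  string starts with a self-delimited `⟨u, ε⟩` with probability `1` (`CWrap.kernelProb_family_ge`
  with the trivial event);
* **`map_readOff_kernel_eq`** — the law of the vector READ OFF the block's output
  (`decodeIntVec n ∘ fstF`, the reading of `GIVPPost.readVec`) IS the law of the vector decoded from
  the sampler's output (`decodeLatticeVector n`, the reading of `UniformQCircuitFamily.SamplesDGS`):
  eventwise domination from `CWrap.kernelProb_family_ge` and `PMF.eq_of_forall_toOuterMeasure_le`;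
* `fstF_append_of_wellFormed`, `blk_zero_eq`, `drop_blk_eq_segment_append`,
  `candVec_eq_readVec_segment` (the answer reader of `GIVPPost` reads the segment of
  `PolyCopiesIdxLaw`: the layout polynomials are those of the copies), `inputIdx_eq` (copy `j` runs
  the block on `⟨encode I, e_j⟩`);
* independent products: `indepLaw_cast` (transport along `K = K'`) and
  `indepLaw_map_block_eq_iidPMF` — a block of coordinates whose pushed laws agree is iid after the
  push (from the tree's `indepLaw_map_pi` and `LWE.indepLaw_map_middle_eq_iidPMF`).

Part B (`Regev2009.GIVPMachine`) — the machine and its correctness: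

* the deterministic half (`postOut_spec`, `isSolution_of_maxNormSq_le`, `maxNormSq_le_of_goodGroup`,
  `exists_lllInstance`, `dichotomy`): by `RowSelect.post_spec` the selection ALWAYS consists of `n`
  linearly independent vectors of `L(B)` no longer than the LLL basis, and no longer than
  `max ‖s‖` over any group of lattice vectors spanning `ℝⁿ`; with Regev's dichotomy
  (`RegevRadiusSearch.lll_short_or_exists_radius`: the LLL basis is shorter than `φ`, or some radius
  `rᵢ = 2ᵏ/2ⁱ`, `i ≤ 2n + 1`, lies in `(φ, 2φ]`; the scale `2ᵏ`, `k = ⌈|bin M|/2⌉`, `scaleExp`);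
* the probabilistic half (`kernelProb_copies_ge`, `eventually_failure_le`): the segments of the
  copies are independent (`PolyCopiesIdx.kernel_map_segments`), each block reads, with probability
  one, the vector the sampler would output (Part A), the `n²` blocks of the good group are iid with
  the sampler's output-vector law at the good radius, which is within `ν(n)` of `D_{L,rᵢ}`
  (`SamplesDGS`), so by Cor. 3.16 / Lemma 2.5 (`RegevDGSSamplesAnalysis`) they are lattice vectors
  spanning `ℝⁿ` of norms `≤ rᵢ√n ≤ 2√n φ` except with probability
  `n(9/10)ⁿ + n²(11/9)2⁻ⁿ + n²ν(n) ≤ 1/3` for large `n`;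
* **`regev_dgs_to_givp_quantum`** — `h₃` verbatim — and **`regev_lwe_to_sivp_quantum_of_h12`**:
  pqc.S19 from `h₁` (average-case bridge) and `h₂` (Thm. 3.1 in machine form) only.

All proved; no named fact is introduced (the `def`s `gcanon`, `readOff`, `scaleExp`, `copies` are
the machine's own maps and parameters).

## References

* O. Regev, *On lattices, learning with errors, random linear codes, and cryptography*, J. ACM 56
  (2009), art. 34, Lemma 3.17 with Cor. 3.16, Lemma 2.5, Claim 2.13 (proof, p. 21 of
  arXiv:2401.03703) [Regev2009].
* C. H. Bennett, E. Bernstein, G. Brassard, U. Vazirani, *Strengths and weaknesses of quantum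
  computing*, SIAM J. Comput. 26 (1997), Thm. 4.13–4.14 (independent copies; subroutine calls)
  [BennettBernsteinBrassardVazirani1997].
* A. K. Lenstra, H. W. Lenstra, L. Lovász, Math. Ann. 261 (1982), Prop. 1.26 [LenstraLenstraLovasz1982].
* S. Arora, B. Barak, *Computational Complexity: A Modern Approach*, CUP 2009, §1.3 [AroraBarak2009].
-/

noncomputable section

namespace Literature.Computability.Cryptography

namespace Regev2009.GIVPBlocks

open _root_.Computability Literature.Computability.Complexity Literature.Computability.Complexity.Brick
  Literature.Computability.QuantumComplexity Literature.Probability.Distributions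
  Literature.Algebra.EuclideanLattices
open scoped ENNReal

/-! ### The canonicalising post-processor of a block -/

/-- **The post-processor of a block**: `⟨x, y⟩ ↦ ⟨fstF y, ε⟩` — the first self-delimited component
of the sampler's output, re-encoded at the front. [folklore] -/
def gcanon : List Bool → List Bool := fanoutFn (fstF ∘ sndF) fun _ => []

/-- `gcanon ∈ FP`. [cite: AroraBarak2009, §1.3] -/
theorem gcanon_mem_FP : gcanon ∈ FP :=
  fanoutFn_mem_FP (comp_mem_FP fstF_mem_FP sndF_mem_FP) (const_mem_FP [])

/-- `gcanon ⟨x, y⟩ = ⟨fstF y, ε⟩`. [folklore] -/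
@[simp] theorem gcanon_boolPair (x y : List Bool) : gcanon (boolPair x y) = boolPair (fstF y) [] := by
  simp [gcanon, fanoutFn_apply]

/-! ### The block: a classical wrap of the sampler -/

/-- The wrap parameters of a block: pre-processor `q`, the sampler's family, post-processor `gcanon`.
[folklore] -/
structure IsBlockParams (P : CWrap.Params) (q : List Bool → List Bool) (D : UniformQCircuitFamily) : Prop where
  /-- the pre-processor is the query map -/
  h_eq : P.h = q
  /-- the post-processor is `gcanon` -/
  g_eq : P.g = gcanon
  /-- the wrapped family is the sampler -/
  F_eq : P.F = D.family

/-- **Block parameters exist** for every `FP` query map (`CWrap.exists_params`). [cite: BennettBernsteinBrassardVazirani1997, Thm. 4.14] -/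
theorem exists_blockParams {q : List Bool → List Bool} (hq : q ∈ FP) (D : UniformQCircuitFamily) :
    ∃ P : CWrap.Params, IsBlockParams P q D := by
  obtain ⟨P, h1, h2, h3⟩ := CWrap.exists_params hq gcanon_mem_FP D.isUniform
  exact ⟨P, ⟨h1, h2, h3⟩⟩

variable {P : CWrap.Params} {q : List Bool → List Bool} {D : UniformQCircuitFamily}

/-- The block is oracle-free. [folklore] -/
theorem block_isOracleFree (hP : IsBlockParams P q D) : (CWrap.family P).IsOracleFree :=
  CWrap.family_isOracleFree P (by rw [hP.F_eq]; exact D.isOracleFree)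

/-- The block is uniform. [folklore] -/
theorem block_isUniform (hP : IsBlockParams P q D) : (CWrap.family P).IsUniform :=
  CWrap.family_isUniform P (by rw [hP.F_eq]; exact D.isUniform)

/-- **Well-formed strings**: those starting with a self-delimited pair `⟨u, ε⟩`. [folklore] -/
def WellFormed (z : List Bool) : Prop := ∃ u : List Bool, boolPair u [] <+: z

/-- A well-formed string reads as its first component, whatever follows. [folklore] -/
theorem fstF_eq_of_prefix {u z : List Bool} (h : boolPair u [] <+: z) (t : List Bool) : fstF (z ++ t) = u := by
  obtain ⟨r, rfl⟩ := h
  rw [List.append_assoc, GIVPPost.boolPair_nil_append, fstF_boolPair]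

/-- A well-formed string followed by anything reads the same. [folklore] -/
theorem fstF_append_of_wellFormed {z : List Bool} (h : WellFormed z) (t : List Bool) : fstF (z ++ t) = fstF z := by
  obtain ⟨u, hu⟩ := h
  rw [fstF_eq_of_prefix hu t, ← fstF_eq_of_prefix hu [], List.append_nil]

/-- Kernel probabilities of a uniform family as outer measures. [folklore] -/
theorem kernelProb_eq_toReal (F : QCircuitFamily cliffordT) (x : List Bool) (E : Set (List Bool)) :
    F.kernelProb 0 x E = ((F.kernel 0 x).toOuterMeasure E).toReal := rfl

/-- Kernel outer measures are at most `1`. [folklore] -/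
theorem toOuterMeasure_kernel_le_one (F : QCircuitFamily cliffordT) (x : List Bool) (E : Set (List Bool)) :
    (F.kernel 0 x).toOuterMeasure E ≤ 1 :=
  (PMF.toOuterMeasure_mono _ (Set.subset_univ _)).trans_eq ((PMF.toOuterMeasure_apply_eq_one_iff _ _).2 (Set.subset_univ _))

/-- The domination of `CWrap.kernelProb_family_ge`, as outer measures. [cite: BennettBernsteinBrassardVazirani1997, Thm. 4.14] -/
theorem toOuterMeasure_le_of_block (hP : IsBlockParams P q D) (x : List Bool) (R : Set (List Bool)) :
    (D.kernel (q x)).toOuterMeasure R ≤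
      ((CWrap.family P).kernel 0 x).toOuterMeasure {z | ∃ y ∈ R, boolPair (fstF y) [] <+: z} := by
  have h := CWrap.kernelProb_family_ge P x (fun _ => R)
  rw [hP.h_eq, hP.g_eq, hP.F_eq] at h
  simp only [gcanon_boolPair] at h
  rw [kernelProb_eq_toReal, kernelProb_eq_toReal] at h
  exact (ENNReal.toReal_le_toReal (ne_top_of_le_ne_top ENNReal.one_ne_top (toOuterMeasure_kernel_le_one _ _ _))
    (ne_top_of_le_ne_top ENNReal.one_ne_top (toOuterMeasure_kernel_le_one _ _ _))).1 h

/-- **The block's output is well formed with probability `1`.** [cite: BennettBernsteinBrassardVazirani1997, Thm. 4.14] -/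
theorem toOuterMeasure_wellFormed_eq_one (hP : IsBlockParams P q D) (x : List Bool) :
    ((CWrap.family P).kernel 0 x).toOuterMeasure {z | WellFormed z} = 1 := by
  refine le_antisymm (toOuterMeasure_kernel_le_one _ _ _) ?_
  have h := toOuterMeasure_le_of_block hP x Set.univ
  rw [(PMF.toOuterMeasure_apply_eq_one_iff _ _).2 (Set.subset_univ _)] at h
  refine h.trans (MeasureTheory.OuterMeasure.mono _ ?_)
  rintro z ⟨y, -, hy⟩
  exact ⟨fstF y, hy⟩

/-- The complement: ill-formed outputs have probability `0`. [folklore] -/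
theorem toOuterMeasure_not_wellFormed_eq_zero (hP : IsBlockParams P q D) (x : List Bool) :
    ((CWrap.family P).kernel 0 x).toOuterMeasure {z | ¬ WellFormed z} = 0 := by
  have h1 := (PMF.toOuterMeasure_apply_eq_one_iff _ _).1 (toOuterMeasure_wellFormed_eq_one hP x)
  rw [PMF.toOuterMeasure_apply_eq_zero_iff]
  exact Set.disjoint_left.2 fun z hz hz' => hz' (h1 hz)

/-! ### The law of the vector read off a block -/

/-- **The vector read off the block's output** (what the post-processor of the machine reads):
`decodeIntVec n (fstF z)`. [cite: Regev2009, Lemma 3.17 (proof)] -/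
def readOff (n : ℕ) (z : List Bool) : Fin n → ℤ := decodeIntVec n (fstF z)

/-- `GIVPPost.readVec` is the list of `readOff`. [folklore] -/
theorem readVec_eq_ofFn_readOff (n : ℕ) (z : List Bool) : GIVPPost.readVec n (fstF z) = List.ofFn (readOff n z) :=
  GIVPPost.readVec_eq_ofFn_decodeIntVec n (fstF z)

/-- **The law of the vector read off the block IS the law of the vector decoded from the sampler's
output** (`decodeLatticeVector n = decodeIntVec n ∘ fstF`): the block's reading dominates the
sampler's eventwise (`CWrap.kernelProb_family_ge`: on the prefix `⟨fstF y, ε⟩` the reader returns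
`decodeIntVec n (fstF y)`), and two laws comparable on every event are equal.
[cite: BennettBernsteinBrassardVazirani1997, Thm. 4.14] [cite: Regev2009, Lemma 3.17 (proof)] -/
theorem map_readOff_kernel_eq (hP : IsBlockParams P q D) (n : ℕ) (x : List Bool) :
    ((CWrap.family P).kernel 0 x).map (readOff n) = (D.kernel (q x)).map (decodeLatticeVector n) := by
  refine PMF.eq_of_forall_toOuterMeasure_le fun S => ?_
  rw [PMF.toOuterMeasure_map_apply, PMF.toOuterMeasure_map_apply]
  refine (toOuterMeasure_le_of_block hP x _).trans (MeasureTheory.OuterMeasure.mono _ ?_)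
  rintro z ⟨y, hy, hpre⟩
  change decodeIntVec n (fstF z) ∈ S
  have hz : fstF z = fstF y := by
    have := fstF_eq_of_prefix hpre []
    rwa [List.append_nil] at this
  rw [hz]
  exact hy

/-! ### The segments of the copies are read by the answer reader -/

section Segments

variable (Pc : PolyCopies.Params)

/-- The layout of the copies is the layout used by the post-processor (same polynomials). [folklore] -/
theorem blk_zero_eq (m j : ℕ) :
    PolyCopiesIdx.blk Pc m j 0 = GIVPPost.baseOf Pc.pF Pc.pK m + j * GIVPPost.bOf Pc.pF Pc.pK m := by
  simp only [PolyCopiesIdx.blk, PolyCopiesIdx.base, PolyCopiesIdx.b, PolyCopiesIdx.nIn, PolyCopiesIdx.K,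
    GIVPPost.baseOf, GIVPPost.bOf, GIVPPost.nInOf, GIVPPost.Kof, Nat.add_zero]

/-- The number of copies is the one used by the post-processor. [folklore] -/
theorem K_eq (m : ℕ) : PolyCopiesIdx.K Pc m = GIVPPost.Kof Pc.pK m := rfl

/-- The string from the start of block `j` on is the segment of copy `j` followed by the rest. [folklore] -/
theorem drop_blk_eq_segment_append (m : ℕ) (w : List Bool) (j : ℕ) :
    w.drop (PolyCopiesIdx.blk Pc m j 0) = PolyCopiesIdx.segment Pc m w j ++
      (w.drop (PolyCopiesIdx.blk Pc m j 0)).drop (PolyCopiesIdx.nIn Pc m + Pc.F.ancillas (PolyCopiesIdx.nIn Pc m)) := by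
  rw [PolyCopiesIdx.segment, List.take_append_drop]

/-- **On a well-formed segment the answer reader reads the segment**: `candVec` of the
post-processor (which reads `fstF` from the start of the block) equals the reading of the segment.
[cite: Regev2009, Lemma 3.17 (proof)] -/
theorem candVec_eq_readVec_segment (I : LatticeInstance) (w : List Bool) (j : ℕ)
    (hwf : WellFormed (PolyCopiesIdx.segment Pc (GIVPPost.inLen I) w j)) :
    GIVPPost.candVec Pc.pF Pc.pK I w j = GIVPPost.readVec I.n (fstF (PolyCopiesIdx.segment Pc (GIVPPost.inLen I) w j)) := by
  rw [GIVPPost.candVec, ← blk_zero_eq, drop_blk_eq_segment_append, show (boolUnpair _).1 = fstF _ from rfl,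
    fstF_append_of_wellFormed hwf]

/-- The copies' input made from an instance: `⟨encode I, ε⟩`, of length `inLen I`. [folklore] -/
theorem length_boolPair_encode_nil (I : LatticeInstance) : (boolPair I.encode []).length = GIVPPost.inLen I := by
  rw [length_boolPair, GIVPPost.inLen]; rfl

/-- **The input of copy `j` is `⟨encode I, e_j⟩`.** [cite: BennettBernsteinBrassardVazirani1997, Thm. 4.14 (proof)] -/
theorem inputIdx_eq (I : LatticeInstance) (j : ℕ) :
    PolyCopiesIdx.inputIdx Pc (boolPair I.encode []) j =
      boolPair I.encode (GIVPQuery.oneHot (PolyCopiesIdx.K Pc (GIVPPost.inLen I)) j) := by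
  rw [PolyCopiesIdx.inputIdx, GIVPPost.boolPair_nil_append, length_boolPair_encode_nil]
  rfl

end Segments

/-! ### Independent products: coordinatewise maps, transport, iid blocks -/

section Indep

variable {α β : Type}

/-- Transport of an independent product along an equality of arities. [folklore] -/
theorem indepLaw_cast {K K' : ℕ} (h : K = K') (p : Fin K → PMF α) :
    (indepLaw K p).map (fun v => fun j : Fin K' => v (Fin.cast h.symm j)) = indepLaw K' (fun j => p (Fin.cast h.symm j)) := by
  subst h
  simp only [Fin.cast_eq_self]
  exact PMF.map_id _

/-- **A block of coordinates with a common pushed law is iid after the push**: in `⨂_{j<K} p j`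
with `K = a + (b + c)`, if `(f)_* (p (a + t)) = μ` for all `t < b`, then the law of
`(f (v (a + t)))_{t<b}` is `μ^{⊗ b}`. [folklore] -/
theorem indepLaw_map_block_eq_iidPMF {K a b c : ℕ} (hK : K = a + (b + c)) (p : Fin K → PMF α) (f : α → β)
    (μ : PMF β) (hμ : ∀ t : Fin b, (p (Fin.cast hK.symm (Fin.natAdd a (Fin.castAdd c t)))).map f = μ) :
    (indepLaw K p).map (fun v => fun t : Fin b => f (v (Fin.cast hK.symm (Fin.natAdd a (Fin.castAdd c t))))) =
      LWE.iidPMF μ b := by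
  -- push coordinatewise, transport to `a + (b + c)`, take the middle block
  have h1 := indepLaw_map_pi K p (fun _ => f)
  have h2 := indepLaw_cast hK (fun j => (p j).map f)
  have h3 := LWE.indepLaw_map_middle_eq_iidPMF (a := a) (b := b) (c := c)
    (fun j => (p (Fin.cast hK.symm j)).map f) μ hμ
  have hcomp : (fun v : Fin K → α => fun t : Fin b => f (v (Fin.cast hK.symm (Fin.natAdd a (Fin.castAdd c t))))) =
      (fun w : Fin (a + (b + c)) → β => fun t : Fin b => w (Fin.natAdd a (Fin.castAdd c t))) ∘
        ((fun v : Fin K → β => fun j : Fin (a + (b + c)) => v (Fin.cast hK.symm j)) ∘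
          (fun v : Fin K → α => fun j => f (v j))) := rfl
  rw [hcomp, ← PMF.map_comp, ← PMF.map_comp, h1, h2, h3]

end Indep

end Regev2009.GIVPBlocks

namespace Regev2009.GIVPMachine

open _root_.Computability Filter Polynomial Literature.Computability.Complexity
  Literature.Computability.Complexity.Brick Literature.Computability.QuantumComplexity
  Literature.Probability.Distributions Literature.Algebra.EuclideanLattices
  Literature.LinearAlgebra.Matrix Literature.LinearAlgebra.Matrix.Berkowitz Literature.LinearAlgebra.Matrix.RowSelect
  Literature.Computability.Complexity.RowSelectFP Literature.Computability.Complexity.IntDetFP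
open scoped ENNReal Matrix

/-! ### The LLL fallback: rows of the LLL basis are independent lattice vectors -/

/-- Integer rows that are `ℝ`-independent after the cast are `ℤ`-independent. [folklore] -/
theorem linearIndependent_int_of_vec {I : LatticeInstance} (hI : I.IsNonsingular) :
    LinearIndependent ℤ (fun i => I.basis i) := by
  have h := (LatticeInstance.linearIndependent_vec hI).restrict_scalars (R := ℤ) (smul_left_injective ℤ one_ne_zero)
  have e : I.vec = intVecToEuclidean I.n ∘ fun i => I.basis i := rfl
  rw [e] at h
  exact LinearIndependent.of_comp _ h

/-- A lattice vector with integer coordinates is an integer combination of the rows. [folklore] -/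
theorem exists_vecMul_of_mem_lattice {I : LatticeInstance} {v : Fin I.n → ℤ} (h : intVecToEuclidean I.n v ∈ I.lattice) :
    ∃ z : Fin I.n → ℤ, z ᵥ* I.basis = v := by
  obtain ⟨z, hz⟩ := (I.mem_lattice_iff _).1 h
  exact ⟨z, intVecToEuclidean_injective I.n hz⟩

/-- Conversely an integer combination of the rows is a lattice vector. [folklore] -/
theorem mem_lattice_of_vecMul {I : LatticeInstance} {v : Fin I.n → ℤ} (h : ∃ z : Fin I.n → ℤ, z ᵥ* I.basis = v) :
    intVecToEuclidean I.n v ∈ I.lattice := by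
  obtain ⟨z, rfl⟩ := h
  exact I.ofCoeffs_mem_lattice z

/-- **The rows of the LLL basis**: linearly independent integer combinations of the rows of `B`.
[cite: LenstraLenstraLovasz1982, Prop. 1.26] -/
theorem lllRows_spec {I : LatticeInstance} (hI : I.IsNonsingular) :
    LinearIndependent ℤ (fun i => (SimApproxLLL.lllOut I).basis i) ∧
      ∀ i, ∃ z : Fin I.n → ℤ, z ᵥ* I.basis = (SimApproxLLL.lllOut I).basis i := by
  have hI' := SimApproxLLL.lllOut_isNonsingular hI
  refine ⟨linearIndependent_int_of_vec hI', fun i => exists_vecMul_of_mem_lattice ?_⟩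
  have hmem : (SimApproxLLL.lllOut I).vec i ∈ (SimApproxLLL.lllOut I).lattice := Submodule.subset_span ⟨i, rfl⟩
  rw [(SimApproxLLL.lllOut_spec hI).1] at hmem
  exact hmem

/-! ### The selection is always a valid answer -/

variable (pF pK : Polynomial ℕ)

/-- Every vector handed to the selection has length `n`. [folklore] -/
theorem forall_length_groupsOf (I : LatticeInstance) (Y : List Bool) :
    ∀ S ∈ GIVPPost.groupsOf pF pK I Y, ∀ v ∈ S, v.length = I.n := by
  intro S hS v hv
  simp only [GIVPPost.groupsOf, List.mem_map] at hS
  obtain ⟨g, -, rfl⟩ := hS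
  rw [List.mem_map] at hv
  obtain ⟨t, -, rfl⟩ := hv
  exact GIVPPost.length_readVec _ _

/-- **The selection is always `n` linearly independent lattice vectors, no longer than the LLL
basis, and no longer than any good group** (`RowSelect.post_spec`, `RowSelect.maxNormSq_post_le_of_group`).
[cite: Regev2009, Lemma 3.17 (proof)] -/
theorem postOut_spec {I : LatticeInstance} (hI : I.IsNonsingular) (Y : List Bool) :
    ∃ C : Matrix (Fin I.n) (Fin I.n) ℤ, GIVPPost.postOut pF pK I Y = rows C ∧
      LinearIndependent ℤ (fun i => C i) ∧ (∀ i, ∃ z : Fin I.n → ℤ, z ᵥ* I.basis = C i) ∧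
      RowSelect.maxNormSq (rows C) ≤ RowSelect.maxNormSq (GIVPPost.basisRows (SimApproxLLL.lllOut I)) ∧
      ∀ S ∈ GIVPPost.groupsOf pF pK I Y, (∀ v ∈ S, ∃ z : Fin I.n → ℤ, List.ofFn (z ᵥ* I.basis) = v) →
        RowSelect.realSpan I.n S = ⊤ → ∀ b : ℤ, 0 ≤ b → (∀ v ∈ S, RowSelect.normSq v ≤ b) → RowSelect.maxNormSq (rows C) ≤ b := by
  obtain ⟨hli, hmem⟩ := lllRows_spec hI
  obtain ⟨C, hC, hCi, hCm, hle, -⟩ := post_spec detCorrect_detZ I.basis hI (SimApproxLLL.lllOut I).basis hli hmem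
    (GIVPPost.groupsOf pF pK I Y) (forall_length_groupsOf pF pK I Y)
  refine ⟨C, hC.symm, hCi, hCm, hle, fun S hS hSmem hspan b hb hSb => ?_⟩
  rw [hC]
  exact maxNormSq_post_le_of_group detCorrect_detZ I.basis hI _ _ hS (forall_length_groupsOf pF pK I Y S hS) hSmem hspan hb hSb

/-- The squared norm of an integer vector in `ℝⁿ` is its `RowSelect.normSq`. [folklore] -/
theorem norm_sq_eq_normSq_ofFn (n : ℕ) (v : Fin n → ℤ) : ‖intVecToEuclidean n v‖ ^ 2 = (RowSelect.normSq (List.ofFn v) : ℝ) := by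
  rw [norm_intVecToEuclidean, Real.sq_sqrt (Finset.sum_nonneg fun _ _ => sq_nonneg _), normSq_ofFn, dotProduct]
  push_cast
  exact Finset.sum_congr rfl fun _ _ => by ring

/-- Rows are no longer than the largest squared norm allows. [folklore] -/
theorem norm_le_of_maxNormSq_le {n : ℕ} (C : Matrix (Fin n) (Fin n) ℤ) {β : ℝ} (hβ : 0 ≤ β)
    (h : (RowSelect.maxNormSq (rows C) : ℝ) ≤ β ^ 2) (i : Fin n) : ‖intVecToEuclidean n (C i)‖ ≤ β := by
  have h1 : (RowSelect.normSq (List.ofFn (C i)) : ℝ) ≤ RowSelect.maxNormSq (rows C) := by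
    exact_mod_cast normSq_le_maxNormSq (by rw [rows, List.mem_ofFn]; exact ⟨i, rfl⟩)
  refine (abs_le_of_sq_le_sq' ?_ hβ).2
  rw [norm_sq_eq_normSq_ofFn]
  linarith

/-- **A valid answer**: if the selection's largest squared norm is at most `β²`, the selection
solves `GIVP` with bound `β`. [cite: Regev2009, Lemma 3.17 (proof)] -/
theorem isSolution_of_maxNormSq_le {I : LatticeInstance} {C : Matrix (Fin I.n) (Fin I.n) ℤ}
    (hCi : LinearIndependent ℤ (fun i => C i)) (hCm : ∀ i, ∃ z : Fin I.n → ℤ, z ᵥ* I.basis = C i)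
    {β : ℝ} (hβ : 0 ≤ β) (h : (RowSelect.maxNormSq (rows C) : ℝ) ≤ β ^ 2) : GIVP.IsSolution β I C :=
  ⟨hCi, fun i => mem_lattice_of_vecMul (hCm i), norm_le_of_maxNormSq_le C hβ h⟩

/-! ### The largest squared norm of a basis and Regev's dichotomy of radii -/

/-- A nonzero integer vector has `normSq ≥ 1`. [folklore] -/
theorem one_le_normSq_of_ne_zero {n : ℕ} {v : Fin n → ℤ} (hv : v ≠ 0) : 1 ≤ RowSelect.normSq (List.ofFn v) := by
  rw [normSq_ofFn, dotProduct]
  obtain ⟨j, hj⟩ : ∃ j, v j ≠ 0 := by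
    by_contra h
    push Not at h
    exact hv (funext h)
  have h1 : 1 ≤ v j * v j := by nlinarith [sq_pos_of_ne_zero hj]
  have h2 : ∑ i ∈ (Finset.univ.erase j), v i * v i ≥ 0 := Finset.sum_nonneg fun i _ => mul_self_nonneg _
  rw [← Finset.add_sum_erase _ _ (Finset.mem_univ j)]
  linarith

/-- **The largest squared norm of the rows of a nonsingular integer matrix is attained and
positive** (positive dimension). [folklore] -/
theorem exists_normSq_eq_max {J : LatticeInstance} (hJ : J.IsNonsingular) (hn : 0 < J.n) :
    ∃ j₀ : Fin J.n, RowSelect.normSq (List.ofFn (J.basis j₀)) = RowSelect.maxNormSq (rows J.basis) ∧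
      1 ≤ RowSelect.maxNormSq (rows J.basis) := by
  have hrow : ∀ j : Fin J.n, J.basis j ≠ 0 := fun j hj =>
    hJ (Matrix.det_eq_zero_of_row_eq_zero j fun k => by rw [hj]; rfl)
  have hle : ∀ j : Fin J.n, RowSelect.normSq (List.ofFn (J.basis j)) ≤ RowSelect.maxNormSq (rows J.basis) := fun j =>
    normSq_le_maxNormSq (by rw [rows, List.mem_ofFn]; exact ⟨j, rfl⟩)
  have hpos : 1 ≤ RowSelect.maxNormSq (rows J.basis) := (one_le_normSq_of_ne_zero (hrow ⟨0, hn⟩)).trans (hle ⟨0, hn⟩)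
  rcases RowSelectFP.foldl_max_mem ((rows J.basis).map RowSelect.normSq) 0 with h | h
  · exfalso
    have : RowSelect.maxNormSq (rows J.basis) = 0 := h
    omega
  · change RowSelect.maxNormSq (rows J.basis) ∈ _ at h
    rw [List.mem_map] at h
    obtain ⟨v, hv, hvn⟩ := h
    rw [rows, List.mem_ofFn] at hv
    obtain ⟨j₀, rfl⟩ := hv
    exact ⟨j₀, hvn, hpos⟩

/-- The real norm of a row is its integer squared norm. [folklore] -/
theorem norm_sq_vec (J : LatticeInstance) (j : Fin J.n) :
    ‖J.vec j‖ ^ 2 = (RowSelect.normSq (List.ofFn (J.basis j)) : ℝ) :=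
  norm_sq_eq_normSq_ofFn J.n _

/-- The exponent of the scale `2ᵏ` attached to a largest squared norm `M`: `k = ⌈|bin M|/2⌉`
(`GIVPQuery.radiusExp I = scaleExp (GIVPQuery.maxSq I)` by `rfl`). [cite: Regev2009, Lemma 3.17 (proof)] -/
def scaleExp (M : ℤ) : ℕ := (M.toNat.size + 1) / 2

/-- `M < 4ᵏ`. [folklore] -/
theorem lt_four_pow_scaleExp (M : ℤ) : M.toNat < 4 ^ scaleExp M := by
  rw [scaleExp, show (4 : ℕ) = 2 ^ 2 by norm_num, ← pow_mul]
  refine lt_of_lt_of_le (Nat.lt_size_self _) (Nat.pow_le_pow_right (by norm_num) ?_)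
  omega

/-- `4^{k-1} ≤ M` for `M ≥ 1`. [folklore] -/
theorem four_pow_scaleExp_sub_one_le {M : ℤ} (h : 1 ≤ M.toNat) : 4 ^ (scaleExp M - 1) ≤ M.toNat := by
  rw [scaleExp, show (4 : ℕ) = 2 ^ 2 by norm_num, ← pow_mul]
  have hs : 0 < M.toNat.size := Nat.size_pos.2 h
  apply Nat.lt_size.1
  omega

/-- The machine's exponent is the scale exponent of its largest squared norm. [folklore] -/
theorem radiusExp_eq_scaleExp (I : LatticeInstance) : GIVPQuery.radiusExp I = scaleExp (GIVPQuery.maxSq I) := rfl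

/-- **Regev's dichotomy of radii.** For a nonsingular instance `J` of positive dimension whose rows
are LLL-reduced (`δ = 3/4`) and `√2 η_ε(L(J)) ≤ φ` (`0 < ε ≤ 1/10`): EITHER every row is shorter than
`φ` (so the largest squared norm `M ≤ φ²`), OR some radius `rᵢ = 2ᵏ/2ⁱ`, `k = scaleExp M`, with
`i ≤ 2n + 1` satisfies `φ < rᵢ ≤ 2φ` (`RegevRadiusSearch.lll_short_or_exists_radius` with the scale
`R = 2ᵏ`, `λ̃ₙ < 2ᵏ ≤ 2λ̃ₙ`). [cite: Regev2009, Lemma 3.17 (proof, with Claim 2.13)] -/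
theorem dichotomy {J : LatticeInstance} (hJ : J.IsNonsingular) (hn : 0 < J.n) (hred : IsLLLReduced (3 / 4) J.vec)
    {ε φ : ℝ} (hε : 0 < ε) (hε10 : ε ≤ 1 / 10) (hφ : Real.sqrt 2 * smoothingParameter J.lattice ε ≤ φ) :
    (RowSelect.maxNormSq (rows J.basis) : ℝ) ≤ φ ^ 2 ∨
      ∃ i : ℕ, i ≤ 2 * J.n + 1 ∧ φ < (2 : ℝ) ^ scaleExp (RowSelect.maxNormSq (rows J.basis)) / 2 ^ i ∧
        (2 : ℝ) ^ scaleExp (RowSelect.maxNormSq (rows J.basis)) / 2 ^ i ≤ 2 * φ := by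
  have hcoe : ⇑(LatticeInstance.basisOfIsNonsingular hJ) = J.vec := LatticeInstance.coe_basisOfIsNonsingular hJ
  have hL : Literature.Computability.Cryptography.latticeOfBasis (LatticeInstance.basisOfIsNonsingular hJ) = J.lattice := by
    change Submodule.span ℤ (Set.range ⇑(LatticeInstance.basisOfIsNonsingular hJ)) = Submodule.span ℤ (Set.range J.vec)
    rw [hcoe]
  obtain ⟨j₀, hj₀, hM1⟩ := exists_normSq_eq_max hJ hn
  have hrows : ∀ j, RowSelect.normSq (List.ofFn (J.basis j)) ≤ RowSelect.maxNormSq (rows J.basis) := fun j =>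
    normSq_le_maxNormSq (by rw [rows, List.mem_ofFn]; exact ⟨j, rfl⟩)
  have h2nat := lt_four_pow_scaleExp (RowSelect.maxNormSq (rows J.basis))
  have h5nat := four_pow_scaleExp_sub_one_le (M := RowSelect.maxNormSq (rows J.basis)) (by omega)
  have hk1 : 1 ≤ scaleExp (RowSelect.maxNormSq (rows J.basis)) := by
    rw [scaleExp]
    have : 0 < (RowSelect.maxNormSq (rows J.basis)).toNat.size := Nat.size_pos.2 (by omega)
    omega
  have hnsq : ∀ j, ‖J.vec j‖ ^ 2 = (RowSelect.normSq (List.ofFn (J.basis j)) : ℝ) := norm_sq_vec J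
  -- opaque numbers from here on
  generalize scaleExp (RowSelect.maxNormSq (rows J.basis)) = k at hk1 h2nat h5nat ⊢
  generalize RowSelect.maxNormSq (rows J.basis) = M at h2nat h5nat hrows hj₀ hM1 ⊢
  have hM0 : (0 : ℤ) ≤ M := by omega
  have hMnat : ((M.toNat : ℕ) : ℝ) = ((M : ℤ) : ℝ) := by
    rw [← Int.cast_natCast, Int.toNat_of_nonneg hM0]
  have h4 : ((M : ℤ) : ℝ) < (4 : ℝ) ^ k := by
    have := (Nat.cast_lt (α := ℝ)).2 h2nat
    push_cast at this
    rwa [hMnat] at this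
  have h5 : (4 : ℝ) ^ (k - 1) ≤ ((M : ℤ) : ℝ) := by
    have := (Nat.cast_le (α := ℝ)).2 h5nat
    push_cast at this
    rwa [hMnat] at this
  have hnb : ∀ j, ‖LatticeInstance.basisOfIsNonsingular hJ j‖ = ‖J.vec j‖ := fun j => by rw [hcoe]
  -- `‖b j‖ ≤ 2ᵏ`
  have hbR : ∀ j, ‖LatticeInstance.basisOfIsNonsingular hJ j‖ ≤ (2 : ℝ) ^ k := by
    intro j
    have h3 : ((RowSelect.normSq (List.ofFn (J.basis j)) : ℤ) : ℝ) ≤ ((M : ℤ) : ℝ) := Int.cast_le.2 (hrows j)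
    have e : ((2 : ℝ) ^ k) ^ 2 = (4 : ℝ) ^ k := by rw [← pow_mul, mul_comm, pow_mul]; norm_num
    have h1 : ‖J.vec j‖ ^ 2 ≤ ((2 : ℝ) ^ k) ^ 2 := (hnsq j).le.trans (h3.trans (h4.le.trans e.symm.le))
    exact (hnb j).le.trans (abs_le_of_sq_le_sq' h1 (by positivity)).2
  -- `2ᵏ ≤ 2 ‖b j₀‖`
  have hMj₀ : ((M : ℤ) : ℝ) = ‖J.vec j₀‖ ^ 2 := by rw [hnsq j₀, hj₀]
  have hR : (2 : ℝ) ^ k ≤ 2 * ‖LatticeInstance.basisOfIsNonsingular hJ j₀‖ := by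
    have e : ((2 : ℝ) ^ (k - 1)) ^ 2 = (4 : ℝ) ^ (k - 1) := by rw [← pow_mul, mul_comm, pow_mul]; norm_num
    have h1 : ((2 : ℝ) ^ (k - 1)) ^ 2 ≤ ‖J.vec j₀‖ ^ 2 := e.le.trans (h5.trans hMj₀.le)
    have h2 : (2 : ℝ) ^ (k - 1) ≤ ‖J.vec j₀‖ := (abs_le_of_sq_le_sq' h1 (norm_nonneg _)).2
    have h3 : (2 : ℝ) ^ k = 2 * 2 ^ (k - 1) := by rw [← pow_succ', Nat.sub_add_cancel hk1]
    rw [hnb j₀, h3]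
    linarith
  have hred' : IsLLLReduced (3 / 4) ⇑(LatticeInstance.basisOfIsNonsingular hJ) := by rw [hcoe]; exact hred
  have hφ' : Real.sqrt 2 * smoothingParameter
      (Literature.Computability.Cryptography.latticeOfBasis (LatticeInstance.basisOfIsNonsingular hJ)) ε ≤ φ := by rw [hL]; exact hφ
  rcases Literature.Algebra.EuclideanLattices.Regev2009.lll_short_or_exists_radius _ hred' hε hε10 hφ' hbR hR with h | h
  · left
    have h1 : ‖J.vec j₀‖ ≤ φ := (hnb j₀).symm.le.trans (h j₀)
    have h2 : ‖J.vec j₀‖ ^ 2 ≤ φ ^ 2 := pow_le_pow_left₀ (norm_nonneg _) h1 2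
    exact hMj₀.le.trans h2
  · right
    simpa using h

/-- **The LLL basis as an instance over the input dimension** (so that no statement has to
identify `(lllOut I).n` with `I.n` by unfolding the machine): its rows are the rows the
post-processor uses, its largest squared norm is `maxSq I`, it is nonsingular, generates `L(B)`,
and is LLL-reduced. [cite: LenstraLenstraLovasz1982, Prop. 1.26] -/
theorem exists_lllInstance {I : LatticeInstance} (hI : I.IsNonsingular) :
    ∃ B' : Matrix (Fin I.n) (Fin I.n) ℤ,
      GIVPPost.basisRows (SimApproxLLL.lllOut I) = rows B' ∧ GIVPQuery.maxSq I = RowSelect.maxNormSq (rows B') ∧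
      (⟨I.n, B'⟩ : LatticeInstance).IsNonsingular ∧ (⟨I.n, B'⟩ : LatticeInstance).lattice = I.lattice ∧
      IsLLLReduced (3 / 4) (⟨I.n, B'⟩ : LatticeInstance).vec :=
  ⟨(SimApproxLLL.lllOut I).basis, rfl, rfl, SimApproxLLL.lllOut_isNonsingular hI, (SimApproxLLL.lllOut_spec hI).1,
    (SimApproxLLL.lllOut_spec hI).2⟩

/-! ### Bridges: spans, norms, good groups -/

/-- **Spanning in `ℝⁿ` read on lists**: if the integer vectors `u t` span `ℝⁿ` (as points of the
Euclidean space), the real span of their lists is everything. [folklore] -/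
theorem realSpan_eq_top_of_span_eq_top {n N : ℕ} {T : List (List ℤ)} (u : Fin N → Fin n → ℤ)
    (hu : ∀ t, List.ofFn (u t) ∈ T) (h : Submodule.span ℝ (Set.range fun t => intVecToEuclidean n (u t)) = ⊤) :
    RowSelect.realSpan n T = ⊤ := by
  have hmap : Submodule.map ((WithLp.linearEquiv 2 ℝ (Fin n → ℝ)) : EuclideanSpace ℝ (Fin n) →ₗ[ℝ] (Fin n → ℝ))
      (Submodule.span ℝ (Set.range fun t => intVecToEuclidean n (u t))) ≤ RowSelect.realSpan n T := by
    rw [Submodule.map_span]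
    refine Submodule.span_le.2 ?_
    rintro _ ⟨_, ⟨t, rfl⟩, rfl⟩
    exact cast_mem_realSpan (hu t)
  rw [h, Submodule.map_top, LinearEquiv.range] at hmap
  exact top_le_iff.1 hmap

/-- **Short in `ℝⁿ` read on lists**: `‖v‖ ≤ r√n` gives `normSq v ≤ ⌊r² n⌋`. [folklore] -/
theorem normSq_le_floor_of_norm_le {n : ℕ} {v : Fin n → ℤ} {r : ℝ}
    (h : ‖intVecToEuclidean n v‖ ≤ r * Real.sqrt n) : RowSelect.normSq (List.ofFn v) ≤ ⌊r ^ 2 * n⌋ := by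
  rw [Int.le_floor, ← norm_sq_eq_normSq_ofFn]
  have h1 : ‖intVecToEuclidean n v‖ ^ 2 ≤ (r * Real.sqrt n) ^ 2 := pow_le_pow_left₀ (norm_nonneg _) h 2
  rwa [mul_pow, Real.sq_sqrt (Nat.cast_nonneg _)] at h1

/-- **A good group forces a short answer.** If the `g`-th group of answers consists of the lists of
vectors `u t` that are lattice vectors spanning `ℝⁿ` of norms `≤ r√n`, the selection's largest
squared norm is at most `r² n`. [cite: Regev2009, Lemma 3.17 (proof: Cor. 3.16 and Lemma 2.5)] -/
theorem maxNormSq_le_of_goodGroup {I : LatticeInstance} (hI : I.IsNonsingular) (Y : List Bool)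
    {C : Matrix (Fin I.n) (Fin I.n) ℤ}
    (hgrp : ∀ S ∈ GIVPPost.groupsOf pF pK I Y, (∀ v ∈ S, ∃ z : Fin I.n → ℤ, List.ofFn (z ᵥ* I.basis) = v) →
        RowSelect.realSpan I.n S = ⊤ → ∀ b : ℤ, 0 ≤ b → (∀ v ∈ S, RowSelect.normSq v ≤ b) → RowSelect.maxNormSq (rows C) ≤ b)
    {g : ℕ} (hg : g < GIVPPost.Kof pK (GIVPPost.inLen I) / (I.n * I.n)) (u : Fin (I.n * I.n) → Fin I.n → ℤ)
    (hu : ∀ t : Fin (I.n * I.n), GIVPPost.candVec pF pK I Y (g * (I.n * I.n) + t) = List.ofFn (u t))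
    {r : ℝ} (hgood : (fun t => intVecToEuclidean I.n (u t)) ∈ Regev2009.goodVectors I.lattice r) :
    (RowSelect.maxNormSq (rows C) : ℝ) ≤ r ^ 2 * I.n := by
  have _ := hI
  obtain ⟨hmem, hspan, hnorm⟩ := hgood
  set S := (List.range (I.n * I.n)).map fun t => GIVPPost.candVec pF pK I Y (g * (I.n * I.n) + t) with hS
  have hSmem : S ∈ GIVPPost.groupsOf pF pK I Y := by
    rw [GIVPPost.groupsOf, List.mem_map]
    exact ⟨g, List.mem_range.2 hg, rfl⟩
  have hSel : ∀ v ∈ S, ∃ t : Fin (I.n * I.n), v = List.ofFn (u t) := by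
    intro v hv
    rw [hS, List.mem_map] at hv
    obtain ⟨t, ht, rfl⟩ := hv
    exact ⟨⟨t, List.mem_range.1 ht⟩, hu ⟨t, List.mem_range.1 ht⟩⟩
  have hofFn : ∀ t : Fin (I.n * I.n), List.ofFn (u t) ∈ S := by
    intro t
    rw [hS, List.mem_map]
    exact ⟨t, List.mem_range.2 t.2, hu t⟩
  have h1 : ∀ v ∈ S, ∃ z : Fin I.n → ℤ, List.ofFn (z ᵥ* I.basis) = v := by
    intro v hv
    obtain ⟨t, rfl⟩ := hSel v hv
    obtain ⟨z, hz⟩ := exists_vecMul_of_mem_lattice (hmem t)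
    exact ⟨z, by rw [hz]⟩
  have h2 : RowSelect.realSpan I.n S = ⊤ := by
    exact realSpan_eq_top_of_span_eq_top u hofFn hspan
  have h3 : ∀ v ∈ S, RowSelect.normSq v ≤ ⌊r ^ 2 * I.n⌋ := by
    intro v hv
    obtain ⟨t, rfl⟩ := hSel v hv
    have ht := hnorm t
    rw [finrank_euclideanSpace_fin] at ht
    exact normSq_le_floor_of_norm_le ht
  have hb : (0 : ℤ) ≤ ⌊r ^ 2 * I.n⌋ := Int.floor_nonneg.2 (by positivity)
  have h4 := hgrp S hSmem h1 h2 _ hb h3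
  calc (RowSelect.maxNormSq (rows C) : ℝ) ≤ ((⌊r ^ 2 * I.n⌋ : ℤ) : ℝ) := by exact_mod_cast h4
    _ ≤ r ^ 2 * I.n := Int.floor_le _

/-! ### Eventual smallness of the failure probability -/

/-- **The failure bound is eventually below `1/3`**: `n(9/10)ⁿ + n²(11/9)2⁻ⁿ + n²ν(n) → 0` for a
negligible `ν`. [cite: Regev2009, Lemma 3.17 (proof: "with probability exponentially close to 1")] -/
theorem eventually_failure_le {ν : ℕ → ℝ} (hν : IsNegligible ν) :
    ∀ᶠ n : ℕ in atTop, (n : ℝ) * (9 / 10 : ℝ) ^ n + (n * n : ℕ) * (11 / 9 * (2⁻¹ : ℝ) ^ n) + (n * n : ℕ) * ν n ≤ 1 / 3 := by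
  have h1 : Tendsto (fun n : ℕ => (n : ℝ) * (9 / 10 : ℝ) ^ n) atTop (nhds 0) :=
    tendsto_self_mul_const_pow_of_abs_lt_one (by rw [abs_of_pos (by norm_num)]; norm_num)
  have h2 : Tendsto (fun n : ℕ => (n : ℝ) ^ 2 * (2⁻¹ : ℝ) ^ n) atTop (nhds 0) :=
    tendsto_pow_const_mul_const_pow_of_abs_lt_one 2 (by rw [abs_of_pos (by norm_num)]; norm_num)
  have h3 : Tendsto (fun n : ℕ => (n : ℝ) ^ 2 * ν n) atTop (nhds 0) := hν 2
  have h : Tendsto (fun n : ℕ => (n : ℝ) * (9 / 10 : ℝ) ^ n + (n * n : ℕ) * (11 / 9 * (2⁻¹ : ℝ) ^ n) + (n * n : ℕ) * ν n)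
      atTop (nhds 0) := by
    have := (h1.add (h2.const_mul (11 / 9))).add h3
    simp only [mul_zero, add_zero] at this
    refine this.congr' (Eventually.of_forall fun n => ?_)
    push_cast
    ring
  exact (h.eventually (gt_mem_nhds (by norm_num : (0 : ℝ) < 1 / 3))).mono fun n hn => hn.le

/-! ### Kernel probabilities: monotonicity and sure events -/

/-- Kernel probabilities are monotone in the event. [folklore] -/
theorem kernelProb_mono (F : QCircuitFamily cliffordT) (x : List Bool) {E E' : Set (List Bool)} (h : E ⊆ E') :
    F.kernelProb 0 x E ≤ F.kernelProb 0 x E' :=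
  ENNReal.toReal_mono (ne_top_of_le_ne_top ENNReal.one_ne_top (GIVPBlocks.toOuterMeasure_kernel_le_one _ _ _))
    (MeasureTheory.OuterMeasure.mono _ h)

/-- A sure event has kernel probability `1`. [folklore] -/
theorem kernelProb_eq_one_of_forall (F : QCircuitFamily cliffordT) (x : List Bool) {E : Set (List Bool)} (h : ∀ w, w ∈ E) :
    F.kernelProb 0 x E = 1 := by
  rw [GIVPBlocks.kernelProb_eq_toReal, Set.eq_univ_of_forall h,
    (PMF.toOuterMeasure_apply_eq_one_iff _ _).2 (Set.subset_univ _), ENNReal.toReal_one]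

/-- An event meets a second one up to the complement of the second. [folklore] -/
theorem toOuterMeasure_le_inter_add_compl {Ω : Type} (μ : PMF Ω) (A B : Set Ω) :
    μ.toOuterMeasure A ≤ μ.toOuterMeasure (A ∩ B) + μ.toOuterMeasure Bᶜ := by
  refine (MeasureTheory.OuterMeasure.mono _ ?_).trans (MeasureTheory.measure_union_le _ _)
  intro w hw
  by_cases hB : w ∈ B
  · exact Or.inl ⟨hw, hB⟩
  · exact Or.inr hB

/-! ### The machine: pre-processor, copies of the block, post-processor -/

/-- **The pre-processor of the outer wrap**: `x ↦ ⟨x, ε⟩` is a polynomial-time string function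
(so that copy `j` receives `⟨x, e_j⟩`). [cite: AroraBarak2009, §1.3] -/
theorem exists_preFn : ∃ h : List Bool → List Bool, h ∈ FP ∧ ∀ x, h x = boolPair x [] := by
  obtain ⟨h, hh, hspec⟩ := (CodeFP.id CodeFP.strE).pair (CodeFP.const CodeFP.strE (eβ := CodeFP.strE) ([] : List Bool))
  exact ⟨h, hh, fun x => hspec x⟩

/-- **The copies of the block**: `K = (|x'|)³ + 1` indexed copies of the block `CWrap.family P`.
[cite: BennettBernsteinBrassardVazirani1997, Thm. 4.13] -/
def copies (P : CWrap.Params) (pF : Polynomial ℕ) (hpF : ∀ m, (CWrap.family P).ancillas m ≤ pF.eval m) : PolyCopies.Params :=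
  ⟨CWrap.family P, pF, hpF, X ^ 3⟩

/-- **Enough copies**: `(i + 1) n² ≤ K` for every radius index `i ≤ 2n + 1`. [cite: Regev2009, Lemma 3.17 (proof)] -/
theorem radius_count_le (I : LatticeInstance) {i : ℕ} (hi : i ≤ 2 * I.n + 1) :
    (i + 1) * (I.n * I.n) ≤ GIVPPost.Kof (X ^ 3) (GIVPPost.inLen I) := by
  have h1 := I.n_le_length_encode
  simp only [GIVPPost.Kof, GIVPPost.inLen, eval_pow, eval_X]
  have ha : i + 1 ≤ 2 * I.encode.length + 2 := by omega
  have hb : I.n ≤ 2 * I.encode.length + 2 := by omega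
  have h2 : (i + 1) * (I.n * I.n) ≤ (2 * I.encode.length + 2) * ((2 * I.encode.length + 2) * (2 * I.encode.length + 2)) :=
    Nat.mul_le_mul ha (Nat.mul_le_mul hb hb)
  have h3 : (2 * I.encode.length + 2) * ((2 * I.encode.length + 2) * (2 * I.encode.length + 2)) =
      (2 * I.encode.length + 2) ^ 3 := by ring
  omega

/-- **The radius of the copies of group `i`** is `2ᵏ/2ⁱ`. [cite: Regev2009, Lemma 3.17 (proof)] -/
theorem radius_oneHot {I : LatticeInstance} (hn : 0 < I.n) {K i j : ℕ} (hj : j < K) (hlo : i * (I.n * I.n) ≤ j)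
    (hhi : j < (i + 1) * (I.n * I.n)) :
    GIVPQuery.radius I (GIVPQuery.oneHot K j) = (2 : ℚ) ^ GIVPQuery.radiusExp I / 2 ^ i := by
  rw [GIVPQuery.radius, GIVPQuery.radiusIdx_oneHot I hj]
  have hN : 0 < I.n * I.n := Nat.mul_pos hn hn
  have : j / (I.n * I.n) = i := by
    exact Nat.div_eq_of_lt_le hlo hhi
  rw [this]

/-- **The probability estimate of Lemma 3.17 at machine level.** If the copies `j` of group `i`
(`i n² ≤ j < (i+1) n²`) all query the sampler at a radius `r > 0` with `√2 η_ε(L) ≤ r`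
(`0 < ε ≤ 1/10`), the sampler's output-vector law at `(B, r)` is within `ν` of `D_{L,r}`, and
`r² n ≤ β²`, then the copies' output makes the post-processor return a `GIVP` solution of bound `β`
except with probability `n(9/10)ⁿ + n²(11/9)2⁻ⁿ + n²ν`: the segments are independent
(`PolyCopiesIdx.kernel_map_segments`), well formed almost surely and read as the sampler's vectors
(`GIVPBlocks`), so the `n²` read vectors of group `i` are iid with the sampler's law
(`indepLaw_map_block_eq_iidPMF`) and Regev's estimate (`toReal_toOuterMeasure_iidPMF_goodVectors_compl_le`)
applies; on the good event the selection is short (`maxNormSq_le_of_goodGroup`).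
[cite: Regev2009, Lemma 3.17 (proof)] -/
theorem kernelProb_copies_ge {P : CWrap.Params} {q : List Bool → List Bool} {D : UniformQCircuitFamily}
    (hP : GIVPBlocks.IsBlockParams P q D)
    (hq : ∀ (I : LatticeInstance) (e : List Bool), q (boolPair I.encode e) = GapSVPInstance.encode (I, GIVPQuery.radius I e))
    (pF : Polynomial ℕ) (hpF : ∀ m, (CWrap.family P).ancillas m ≤ pF.eval m)
    {I : LatticeInstance} (hI : I.IsNonsingular) (hn : 0 < I.n)
    {i : ℕ} (hiK : (i + 1) * (I.n * I.n) ≤ GIVPPost.Kof (X ^ 3) (GIVPPost.inLen I))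
    {r : ℚ} (hrad : ∀ j, j < GIVPPost.Kof (X ^ 3) (GIVPPost.inLen I) → i * (I.n * I.n) ≤ j → j < (i + 1) * (I.n * I.n) →
        GIVPQuery.radius I (GIVPQuery.oneHot (GIVPPost.Kof (X ^ 3) (GIVPPost.inLen I)) j) = r)
    {ε ν β : ℝ} (hε : 0 < ε) (hε10 : ε ≤ 1 / 10) (hr : 0 < (r : ℝ))
    (hηr : Real.sqrt 2 * smoothingParameter I.lattice ε ≤ r)
    (hν : (D.outputVectorLaw I.n (GapSVPInstance.encode (I, r))).tvDist
        ((discreteGaussian I.lattice (r : ℝ) 0).map Subtype.val) ≤ ν)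
    (hβ : 0 ≤ β) (hrβ : (r : ℝ) ^ 2 * I.n ≤ β ^ 2) :
    1 - ((I.n : ℝ) * (9 / 10 : ℝ) ^ I.n + (I.n * I.n : ℕ) * (11 / 9 * (2⁻¹ : ℝ) ^ I.n) + (I.n * I.n : ℕ) * ν) ≤
      (PolyCopiesIdx.family (copies P pF hpF)).kernelProb 0 (boolPair I.encode [])
        {Y | ∃ C : Matrix (Fin I.n) (Fin I.n) ℤ, GIVPPost.postOut pF (X ^ 3) I Y = rows C ∧ GIVP.IsSolution β I C} := by
  haveI : IsZLattice ℝ I.lattice := LatticeInstance.isZLattice_of_isNonsingular hI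
  have hNpos : 0 < I.n * I.n := Nat.mul_pos hn hn
  -- the block of coordinates of group `i`
  obtain ⟨c, hK⟩ : ∃ c, GIVPPost.Kof (X ^ 3) (GIVPPost.inLen I) = i * (I.n * I.n) + (I.n * I.n + c) := by
    refine ⟨GIVPPost.Kof (X ^ 3) (GIVPPost.inLen I) - (i * (I.n * I.n) + I.n * I.n), ?_⟩
    have : i * (I.n * I.n) + I.n * I.n ≤ GIVPPost.Kof (X ^ 3) (GIVPPost.inLen I) := by
      simpa [add_mul, one_mul] using hiK
    omega
  generalize hKdef : GIVPPost.Kof (X ^ 3) (GIVPPost.inLen I) = K at hK hrad hiK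
  set emb : Fin (I.n * I.n) → Fin K := fun t => Fin.cast hK.symm (Fin.natAdd (i * (I.n * I.n)) (Fin.castAdd c t)) with hemb_def
  have hemb : ∀ t, (emb t : ℕ) = i * (I.n * I.n) + t := fun t => by simp [emb]
  have hemb_lt : ∀ t : Fin (I.n * I.n), i * (I.n * I.n) + t < (i + 1) * (I.n * I.n) := fun t => by
    have := t.2; simp only [add_mul, one_mul]; omega
  -- names
  have hPcF : (copies P pF hpF).F = CWrap.family P := rfl
  have hKc : PolyCopiesIdx.K (copies P pF hpF) (GIVPPost.inLen I) = K := hKdef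
  -- the law of the segments
  have hseg : ((PolyCopiesIdx.family (copies P pF hpF)).kernel 0 (boolPair I.encode [])).map
      (fun w => fun j : Fin K => PolyCopiesIdx.segment (copies P pF hpF) (GIVPPost.inLen I) w j) =
      indepLaw K (fun j => PolyCopiesIdx.blockLaw (copies P pF hpF) (boolPair I.encode []) j) := by
    have h := PolyCopiesIdx.kernel_map_segments (P := copies P pF hpF) (boolPair I.encode [])
    rw [GIVPBlocks.length_boolPair_encode_nil] at h
    rw [← hKc]
    exact h
  -- the events on the segments
  set readT : (Fin K → List Bool) → Fin (I.n * I.n) → EuclideanSpace ℝ (Fin I.n) :=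
    fun s t => intVecToEuclidean I.n (GIVPBlocks.readOff I.n (s (emb t))) with hreadT
  set W : Set (Fin K → List Bool) := {s | ∀ t, GIVPBlocks.WellFormed (s (emb t))} with hW
  set E : Set (Fin K → List Bool) := readT ⁻¹' Regev2009.goodVectors I.lattice (r : ℝ) with hE
  set Sβ : Set (List Bool) :=
    {Y | ∃ C : Matrix (Fin I.n) (Fin I.n) ℤ, GIVPPost.postOut pF (X ^ 3) I Y = rows C ∧ GIVP.IsSolution β I C} with hSβ
  -- (1) the deterministic half: well-formed good segments make the selection short
  have hdet : (fun w => fun j : Fin K => PolyCopiesIdx.segment (copies P pF hpF) (GIVPPost.inLen I) w j) ⁻¹' (W ∩ E) ⊆ Sβ := by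
    rintro w ⟨hwW, hwE⟩
    obtain ⟨C, hC, hCi, hCm, -, hgrp⟩ := postOut_spec pF (X ^ 3) hI w
    refine ⟨C, hC, isSolution_of_maxNormSq_le hCi hCm hβ ?_⟩
    have hg : i < GIVPPost.Kof (X ^ 3) (GIVPPost.inLen I) / (I.n * I.n) := by
      rw [hKdef]
      exact (Nat.le_div_iff_mul_le hNpos).2 hiK
    have hu : ∀ t : Fin (I.n * I.n), GIVPPost.candVec pF (X ^ 3) I w (i * (I.n * I.n) + t) =
        List.ofFn (GIVPBlocks.readOff I.n (PolyCopiesIdx.segment (copies P pF hpF) (GIVPPost.inLen I) w (emb t))) := by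
      intro t
      have hwf : GIVPBlocks.WellFormed (PolyCopiesIdx.segment (copies P pF hpF) (GIVPPost.inLen I) w (i * (I.n * I.n) + t)) := by
        have h0 : GIVPBlocks.WellFormed (PolyCopiesIdx.segment (copies P pF hpF) (GIVPPost.inLen I) w (emb t)) := hwW t
        rwa [hemb] at h0
      have h1 := GIVPBlocks.candVec_eq_readVec_segment (copies P pF hpF) I w (i * (I.n * I.n) + t) hwf
      rw [GIVPBlocks.readVec_eq_ofFn_readOff] at h1
      rw [hemb]
      exact h1
    exact (maxNormSq_le_of_goodGroup pF (X ^ 3) hI w hgrp hg _ hu hwE).trans hrβ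
  -- the three laws
  set μ := (PolyCopiesIdx.family (copies P pF hpF)).kernel 0 (boolPair I.encode []) with hμ
  set Λ := indepLaw K (fun j => PolyCopiesIdx.blockLaw (copies P pF hpF) (boolPair I.encode []) j) with hΛ
  -- (2) ill-formed segments are null
  have hWnull : Λ.toOuterMeasure Wᶜ = 0 := by
    have hsub : Wᶜ ⊆ ⋃ t : Fin (I.n * I.n), {s : Fin K → List Bool | s (emb t) ∈ {z | ¬ GIVPBlocks.WellFormed z}} := by
      intro s hs
      have hs' : ¬ ∀ t, GIVPBlocks.WellFormed (s (emb t)) := hs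
      push Not at hs'
      obtain ⟨t, ht⟩ := hs'
      exact Set.mem_iUnion.2 ⟨t, ht⟩
    refine le_antisymm ((MeasureTheory.measure_mono hsub).trans (le_of_eq ?_)) bot_le
    refine MeasureTheory.measure_iUnion_null fun t => ?_
    rw [hΛ, LWE.indepLaw_toOuterMeasure_apply_preimage, PolyCopiesIdx.blockLaw_eq_kernel, hPcF]
    exact GIVPBlocks.toOuterMeasure_not_wellFormed_eq_zero hP _
  -- (3) the read vectors of group `i` are iid with the sampler's output-vector law at `(B, r)`
  have hlawT : Λ.map readT = LWE.iidPMF (D.outputVectorLaw I.n (GapSVPInstance.encode (I, r))) (I.n * I.n) := by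
    rw [hΛ]
    refine GIVPBlocks.indepLaw_map_block_eq_iidPMF hK _ (fun z => intVecToEuclidean I.n (GIVPBlocks.readOff I.n z)) _
      fun t => ?_
    rw [PolyCopiesIdx.blockLaw_eq_kernel, hPcF, GIVPBlocks.inputIdx_eq, hKc]
    have hj : ((Fin.cast hK.symm (Fin.natAdd (i * (I.n * I.n)) (Fin.castAdd c t)) : Fin K) : ℕ) = i * (I.n * I.n) + t := hemb t
    rw [hj, show (fun z => intVecToEuclidean I.n (GIVPBlocks.readOff I.n z)) = intVecToEuclidean I.n ∘ GIVPBlocks.readOff I.n from rfl,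
      ← PMF.map_comp, GIVPBlocks.map_readOff_kernel_eq hP, hq,
      hrad _ (by have := hemb_lt t; have := hiK; omega) (Nat.le_add_right _ _) (hemb_lt t), PMF.map_comp]
    rfl
  -- (4) Regev's estimate for `n²` samples of that law
  have hthm := Regev2009.toReal_toOuterMeasure_iidPMF_goodVectors_compl_le I.lattice hε hε10 hr hηr
    (D.outputVectorLaw I.n (GapSVPInstance.encode (I, r))) hν
  rw [finrank_euclideanSpace_fin] at hthm
  -- (5) the chain of inequalities
  have hle1 : ∀ {Ω : Type} (μ : PMF Ω) (A : Set Ω), μ.toOuterMeasure A ≤ 1 := fun μ A =>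
    (MeasureTheory.OuterMeasure.mono _ (Set.subset_univ _)).trans_eq ((PMF.toOuterMeasure_apply_eq_one_iff _ _).2 (Set.subset_univ _))
  set Θ := LWE.iidPMF (D.outputVectorLaw I.n (GapSVPInstance.encode (I, r))) (I.n * I.n) with hΘ
  have h1 : Λ.toOuterMeasure (W ∩ E) ≤ μ.toOuterMeasure Sβ := by
    rw [← hseg, PMF.toOuterMeasure_map_apply]
    exact MeasureTheory.OuterMeasure.mono _ hdet
  have h2 : Λ.toOuterMeasure E ≤ Λ.toOuterMeasure (W ∩ E) := by
    have := toOuterMeasure_le_inter_add_compl Λ E W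
    rwa [hWnull, add_zero, Set.inter_comm] at this
  have h3 : Λ.toOuterMeasure E = Θ.toOuterMeasure (Regev2009.goodVectors I.lattice (r : ℝ)) := by
    rw [← hlawT, PMF.toOuterMeasure_map_apply]
  have h4 : Θ.toOuterMeasure (Regev2009.goodVectors I.lattice (r : ℝ)) =
      1 - Θ.toOuterMeasure (Regev2009.goodVectors I.lattice (r : ℝ))ᶜ := (LWE.one_sub_toOuterMeasure_compl _ _).symm
  have hchain : 1 - Θ.toOuterMeasure (Regev2009.goodVectors I.lattice (r : ℝ))ᶜ ≤ μ.toOuterMeasure Sβ := by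
    rw [← h4, ← h3]; exact h2.trans h1
  -- (6) to real numbers
  rw [GIVPBlocks.kernelProb_eq_toReal]
  show _ ≤ (μ.toOuterMeasure Sβ).toReal
  have hbad : (Θ.toOuterMeasure (Regev2009.goodVectors I.lattice (r : ℝ))ᶜ).toReal ≤
      (I.n : ℝ) * (9 / 10 : ℝ) ^ I.n + (I.n * I.n : ℕ) * (11 / 9 * (2⁻¹ : ℝ) ^ I.n) + (I.n * I.n : ℕ) * ν := hthm
  have hsub : (1 - Θ.toOuterMeasure (Regev2009.goodVectors I.lattice (r : ℝ))ᶜ).toReal =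
      1 - (Θ.toOuterMeasure (Regev2009.goodVectors I.lattice (r : ℝ))ᶜ).toReal := by
    rw [ENNReal.toReal_sub_of_le (hle1 _ _) ENNReal.one_ne_top, ENNReal.toReal_one]
  have hmono := ENNReal.toReal_mono (ne_top_of_le_ne_top ENNReal.one_ne_top (hle1 _ _)) hchain
  rw [hsub] at hmono
  linarith

/-! ### Lemma 3.17: hypothesis `h₃` discharged -/

/-- **The outer wrap**: the machine's success on `encode I` is at least the copies' success on
`⟨encode I, ε⟩` (`CWrap.kernelProb_family_ge`; the answer is read through `decodeIntMatrix_postStr`).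
[cite: BennettBernsteinBrassardVazirani1997, Thm. 4.14] -/
theorem kernelProb_wrap_ge {Pout : CWrap.Params} {hpre g : List Bool → List Bool} (hh : Pout.h = hpre) (hgo : Pout.g = g)
    (hpre_apply : ∀ x, hpre x = boolPair x []) (pF : Polynomial ℕ)
    (hg_apply : ∀ (I : LatticeInstance) (Y : List Bool), g (boolPair I.encode Y) = GIVPPost.postStr pF (X ^ 3) (I, Y))
    (I : LatticeInstance) (β : ℝ) :
    Pout.F.kernelProb 0 (boolPair I.encode [])
        {Y | ∃ C : Matrix (Fin I.n) (Fin I.n) ℤ, GIVPPost.postOut pF (X ^ 3) I Y = rows C ∧ GIVP.IsSolution β I C} ≤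
      (CWrap.family Pout).kernelProb 0 I.encode {w | GIVP.IsSolution β I (decodeIntMatrix I.n w)} := by
  have h := CWrap.kernelProb_family_ge Pout I.encode
    (fun _ => {Y | ∃ C : Matrix (Fin I.n) (Fin I.n) ℤ, GIVPPost.postOut pF (X ^ 3) I Y = rows C ∧ GIVP.IsSolution β I C})
  rw [hh, hgo, hpre_apply] at h
  refine h.trans (kernelProb_mono _ _ ?_)
  rintro z ⟨Y, ⟨C, hC, hsol⟩, hz⟩
  rw [hg_apply] at hz
  show GIVP.IsSolution β I (decodeIntMatrix I.n z)
  rw [GIVPPost.decodeIntMatrix_postStr pF (X ^ 3) hC hz]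
  exact hsol

/-- **Regev 2009, Lemma 3.17 (`GIVP_{2√n φ} ≤ DGS_φ`), at machine level — hypothesis `h₃` of
`regev_lwe_to_sivp_quantum_of_worstCase` PROVED.** For `0 < ε(n) ≤ 1/10` and
`φ(L) ≥ √2 η_ε(L)` (eventually in the dimension), every poly-time uniform quantum family sampling
`DGS_φ` up to a negligible statistical distance yields a poly-time uniform quantum family solving
`GIVP_{2√n φ}` with probability `≥ 2/3` on every nonsingular basis of large dimension: the machine
`CWrap(⟨·, ε⟩, PolyCopiesIdx(CWrap(query, D, gcanon), K = (2|x|+2)³ + 1), post)` — LLL, `n²`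
calls at each radius `rᵢ = 2ᵏ 2⁻ⁱ`, `i < K/n²`, selection of `n` independent short vectors — is
correct by `dichotomy` (Claim 2.13 / Lemma 3.17: some `rᵢ ∈ (φ, 2φ]` unless LLL already suffices)
and `kernelProb_copies_ge` (Cor. 3.16 and Lemma 2.5 on the `n²` iid samples of the good radius).
[cite: Regev2009, Lemma 3.17] -/
theorem regev_dgs_to_givp_quantum :
    ∀ (ε : ℕ → ℝ) (φ : LatticeInstance → ℝ), (∀ n, 0 < ε n ∧ ε n ≤ 1 / 10) →
      (∀ᶠ n in atTop, ∀ I : LatticeInstance, I.n = n → I.IsNonsingular →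
        Real.sqrt 2 * smoothingParameter I.lattice (ε n) ≤ φ I) →
      ∀ (D : UniformQCircuitFamily) (ν : ℕ → ℝ), IsNegligible ν → D.SamplesDGS φ ν →
        ∃ G : UniformQCircuitFamily, G.SolvesGIVP fun I => 2 * Real.sqrt I.n * φ I := by
  intro ε φ hε hφ D ν hν hD
  obtain ⟨q, hqFP, hq⟩ := GIVPQuery.exists_queryFn
  obtain ⟨P, hP⟩ := GIVPBlocks.exists_blockParams hqFP D
  obtain ⟨pF, hpF⟩ := QCircuitFamily.IsUniform.isPolySize_holds (GIVPBlocks.block_isUniform hP)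
  have hpF' : ∀ m, (CWrap.family P).ancillas m ≤ pF.eval m := fun m => (hpF m).2
  have hUc : (PolyCopiesIdx.family (copies P pF hpF')).IsUniform :=
    PolyCopiesIdx.family_isUniform (copies P pF hpF') (GIVPBlocks.block_isUniform hP)
  have hOc : (PolyCopiesIdx.family (copies P pF hpF')).IsOracleFree :=
    PolyCopiesIdx.family_isOracleFree (copies P pF hpF') (GIVPBlocks.block_isOracleFree hP)
  obtain ⟨g, hgFP, hg⟩ := GIVPPost.exists_postFn pF (X ^ 3)
  obtain ⟨hpre, hpreFP, hpre_apply⟩ := exists_preFn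
  obtain ⟨Pout, hh, hgo, hF⟩ := CWrap.exists_params hpreFP hgFP hUc
  refine ⟨⟨CWrap.family Pout, CWrap.family_isOracleFree Pout (by rw [hF]; exact hOc),
    CWrap.family_isUniform Pout (by rw [hF]; exact hUc)⟩, ?_⟩
  -- correctness, for all large dimensions
  unfold UniformQCircuitFamily.SamplesDGS at hD
  unfold UniformQCircuitFamily.SolvesGIVP
  filter_upwards [hD, hφ, eventually_failure_le hν, eventually_gt_atTop 0] with n hDn hφn hδn hn0
  intro I hIn hI
  subst hIn
  show 2 / 3 ≤ (CWrap.family Pout).kernelProb 0 I.encode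
    {w | GIVP.IsSolution (2 * Real.sqrt I.n * φ I) I (decodeIntMatrix I.n w)}
  refine le_trans ?_ (kernelProb_wrap_ge hh hgo hpre_apply pF hg I _)
  rw [hF]
  -- the LLL basis over the input dimension, and the dichotomy of radii
  obtain ⟨B', hrowsB, hmaxB, hJ, hlatJ, hredJ⟩ := exists_lllInstance hI
  have hφ0 : 0 ≤ φ I := le_trans (mul_nonneg (Real.sqrt_nonneg _) (smoothingParameter_nonneg _ _)) (hφn I rfl hI)
  have hβ : 0 ≤ 2 * Real.sqrt I.n * φ I := by positivity
  have hφJ : Real.sqrt 2 * smoothingParameter (⟨I.n, B'⟩ : LatticeInstance).lattice (ε I.n) ≤ φ I := by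
    rw [hlatJ]; exact hφn I rfl hI
  have hn1 : (1 : ℝ) ≤ I.n := by exact_mod_cast hn0
  rcases dichotomy hJ hn0 hredJ (hε I.n).1 (hε I.n).2 hφJ with hshort | ⟨i, hi, hlo, hhi⟩
  · -- the LLL basis is already short: success is certain
    have hsure : ∀ Y, Y ∈ {Y | ∃ C : Matrix (Fin I.n) (Fin I.n) ℤ, GIVPPost.postOut pF (X ^ 3) I Y = rows C ∧
        GIVP.IsSolution (2 * Real.sqrt I.n * φ I) I C} := by
      intro Y
      obtain ⟨C, hC, hCi, hCm, hle, -⟩ := postOut_spec pF (X ^ 3) hI Y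
      refine ⟨C, hC, isSolution_of_maxNormSq_le hCi hCm hβ ?_⟩
      rw [hrowsB] at hle
      have h1 : (RowSelect.maxNormSq (rows C) : ℝ) ≤ RowSelect.maxNormSq (rows B') := by exact_mod_cast hle
      have h2 : φ I ^ 2 ≤ (2 * Real.sqrt I.n * φ I) ^ 2 := by
        rw [mul_pow, mul_pow, Real.sq_sqrt (Nat.cast_nonneg _)]
        nlinarith [sq_nonneg (φ I)]
      linarith
    rw [kernelProb_eq_one_of_forall _ _ hsure]
    norm_num
  · -- a good radius `r = 2ᵏ/2ⁱ`, `i ≤ 2n + 1`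
    have hk : scaleExp (RowSelect.maxNormSq (rows B')) = GIVPQuery.radiusExp I := by
      rw [radiusExp_eq_scaleExp, hmaxB]
    rw [hk] at hlo hhi
    have hrR : (((2 : ℚ) ^ GIVPQuery.radiusExp I / 2 ^ i : ℚ) : ℝ) = (2 : ℝ) ^ GIVPQuery.radiusExp I / 2 ^ i := by
      push_cast; rfl
    generalize hr_def : ((2 : ℚ) ^ GIVPQuery.radiusExp I / 2 ^ i : ℚ) = r at hrR
    have hr : 0 < (r : ℝ) := by rw [hrR]; positivity
    have hlo' : φ I < r := by rw [hrR]; exact hlo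
    have hhi' : (r : ℝ) ≤ 2 * φ I := by rw [hrR]; exact hhi
    have hηr : Real.sqrt 2 * smoothingParameter I.lattice (ε I.n) ≤ r := (hφn I rfl hI).trans hlo'.le
    have hνn := hDn I r rfl hI hlo'
    have hiK := radius_count_le I hi
    have hrad : ∀ j, j < GIVPPost.Kof (X ^ 3) (GIVPPost.inLen I) → i * (I.n * I.n) ≤ j → j < (i + 1) * (I.n * I.n) →
        GIVPQuery.radius I (GIVPQuery.oneHot (GIVPPost.Kof (X ^ 3) (GIVPPost.inLen I)) j) = r :=
      fun j hj hlo hhi => by rw [← hr_def]; exact radius_oneHot hn0 hj hlo hhi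
    have hrβ : (r : ℝ) ^ 2 * I.n ≤ (2 * Real.sqrt I.n * φ I) ^ 2 := by
      rw [mul_pow, mul_pow, Real.sq_sqrt (Nat.cast_nonneg _)]
      have h1 : (r : ℝ) ^ 2 ≤ (2 * φ I) ^ 2 := pow_le_pow_left₀ hr.le hhi' 2
      nlinarith [h1, Nat.cast_nonneg (α := ℝ) I.n]
    have hmain := kernelProb_copies_ge hP hq pF hpF' hI hn0 hiK hrad (hε I.n).1 (hε I.n).2 hr hηr hνn hβ hrβ
    linarith [hδn]

end Regev2009.GIVPMachine

/-! ### pqc.S19 from `h₁`, `h₂` alone -/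

section Corollary

open Filter Regev2009 Literature.Computability.Complexity Literature.Computability.Cryptography.LWE

variable (q : ℕ → ℕ) [∀ n, NeZero (q n)] (α : ℕ → ℝ) (m : ℕ → ℕ)

/-- **pqc.S19 (`regev_lwe_to_sivp_quantum`) from the two remaining named inputs**: with Lemma 3.17
now a theorem (`regev_dgs_to_givp_quantum`), Regev's Theorem 1.1 (SIVP half) follows from the
average-case-to-worst-case bridge `h₁` (Lemma 4.1 + Lemma 4.2 + Lemma 3.6 at machine level) and
Theorem 3.1 as printed `h₂`, by `regev_lwe_to_sivp_quantum_of_worstCase`. [cite: Regev2009, Thm. 1.1, Thm. 3.1, Lemma 3.17] -/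
theorem regev_lwe_to_sivp_quantum_of_h12
    (h₁ : ∀ (_ : IsPolyBounded m) (_ : IsPolyTimeParams q α m)
      (_ : ∀ᶠ n : ℕ in atTop, 0 < α n ∧ α n < 1 ∧ 2 * Real.sqrt n < α n * q n)
      (_ : ∃ Q : UniformQCircuitFamily, SearchLWESolves q (fun n => discretizedGaussian (q n) (α n))
        m (fun n => Q.searchLWESolver n (q n) (m n)) fun _ => 2 / 3),
      ∃ (W : UniformQCircuitFamily) (m' : ℕ → ℕ) (c : ℝ), IsPolyBounded m' ∧
        IsPolyTimeParams q α m' ∧ 0 < c ∧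
        W.SolvesSearchLWEWorstCase q (fun n => discretizedGaussian (q n) (α n)) m'
          fun n => (2 : ℝ) ^ (-(c * n)))
    (h₂ : ∀ (m' : ℕ → ℕ) (_ : IsPolyBounded m') (_ : IsPolyTimeParams q α m')
      (_ : ∀ᶠ n : ℕ in atTop, 0 < α n ∧ α n < 1 ∧ 2 * Real.sqrt n < α n * q n)
      (_ : ∃ (W : UniformQCircuitFamily) (c : ℝ), 0 < c ∧
        W.SolvesSearchLWEWorstCase q (fun n => discretizedGaussian (q n) (α n)) m'
          fun n => (2 : ℝ) ^ (-(c * n)))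
      (ε : ℕ → ℝ), IsNegligible ε → (∀ n, 0 < ε n) →
      ∃ (D : UniformQCircuitFamily) (ν : ℕ → ℝ), IsNegligible ν ∧ D.SamplesDGS (regevDGSBound α ε) ν) :
    regev_lwe_to_sivp_quantum q α m :=
  regev_lwe_to_sivp_quantum_of_worstCase q α m h₁ h₂ GIVPMachine.regev_dgs_to_givp_quantum

end Corollary


end Literature.Computability.Cryptography

end
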